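import Literature.MathematicalPhysics.StatisticalMechanics.HcpFccLatticeSumsLayers
import Summits.AtomisticToContinuum.Crystallization.Theorems.OverbindingBudgetAffineFarUniform

/-!
# Overbinding budget, affine far-core cell (31280 Z2): the WINDOW SUMS `T₃↑, T₆↓` = seven near layers + ONE closed-form far enclosure
# (decomp-a2c lens-4, generation 66, Deliverable G part 2 of 2 = memo NODE-g66 §10 items (T3)+(T4′))

Imports part 1 `…FarUniform` (`layerSum_far_encl_uniform`; transitively the tree window vocabulary of `…FarCoreWindowsB`:
`layerUp`, `layerLo`, `windowSixUp`, `windowTwelveLo`, `windowLabel`, `layerUp_nonneg`, `layerLo_nonneg`) and Literature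
`HcpFccLatticeSumsLayers` (`StackingSums.sum_inv_pow_Ioc_le`).  Uses Mathlib `hasSum_zeta_four` (`ζ(4) = π⁴/90`).  Restates nothing.
PROVED, 0 sorry, standard axioms (probe `TowerTreeG66G.lean`; pins `TowerTreeG66GPins.lean`; must-fail `TowerTreeG66GMustFail.lean`).

* §G5 (pure real analysis, [folklore]) `hasSum_int_far` — `Σ_{k∈ℤ} [|k| ≥ K₀]·w(|k|−K₀) = 2Σ_n w(n)` (`K₀ ≥ 1`);
  ★ `tsum_int_le_near_add_far` — `0 ≤ f`, `f(k) ≤ u(|k|−K₀)` far, partial sums of `u` `≤ U` ⟹ `f` summable and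
  `Σ_k f(k) ≤ Σ_{|k|<K₀} f(k) + 2U`; ★ `near_add_far_le_tsum_int` — the matching LOWER split
  `Σ_{|k|<K₀} f(k) + 2(a·Σ_{m<N} v(m) − c·T) ≤ Σ_k f(k)`; `sum_range_pow_le_of_lt_one` (`Σ_{m<N} Q^m ≤ 1/(1−Q)`).
* §G6 constants: `gamma_three_eq` (`Γ3 = 2`), `gamma_six_eq` (`Γ6 = 120`), `sum_range_inv_pow_four_shift_le`
  (`Σ_{m<N}(m+4)⁻⁴ ≤ π⁴/90 − 1393/1296`, from `ζ(4)`), `sum_range_inv_pow_shift_le` (`Σ_{m<N}(m+4)^{−(d+1)} ≤ 1/(d·3^d)`).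
* §G7 ★★ `windowSixUp_le_near_add_far` — with ONE row (`μ = 2`) and the box enclosures of part 1 (+ `Q < 1`, `0 ≤ bound`):
  `k ↦ layerUp w B 6 k` is summable (NO isometry-closeness hypothesis) and
  `T₃↑(w,B) ≤ Σ_{|k|≤3} layerSum B 6 k (windowLabel w k) + 2·( π/(2√D₁δ₁⁴)·(π⁴/90 − 1393/1296) + (π/√Dlo)·bound/(1−Q) )`;
  ★★ `near_add_far_le_windowTwelveLo` — with ONE row (`μ = 5`), for every `N`:
  `Σ_{|k|≤3} layerSum B 12 k (windowLabel w k) + 2·( π/(5√D₂δ₂¹⁰)·Σ_{m<N}(m+4)⁻¹⁰ − (π/(60√Dlo))·bound/(1−Q) ) ≤ T₆↓(w,B)`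
  and `k ↦ layerLo w B 12 k` is summable.

What this buys for Z2 (memo NODE-g66 §11): per box of the window TABLE the far field costs TWO certified rows (one per exponent)
and closed-form rational arithmetic; what remains per box is the seven near layers `|k| ≤ 3` (F2's `layerSum_far_encl_of_check`
for `k ≠ 0` with near rows, plus the planar layer `k = 0`) — memo §8 (T1) — and the parameter map (T5).
-/

noncomputable section

open MeasureTheory Set Module
open scoped Real InnerProductSpace

namespace Summit.AtomisticToContinuum.Crystallization.Theorems.OverbindingBudgetAffineFarSmoothSplit
open Literature.MathematicalPhysics.StatisticalMechanics Literature.Algebra.EuclideanLattices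
  Literature.Analysis.FunctionSpaces
local notation "E3" => EuclideanSpace ℝ (Fin 3)

/-! ## §G5 Even `ℤ`-sums with a finite window: the near/far splitting lemmas (pure real analysis) -/

section IntSums

/-- The two-sided far family `k ↦ [ |k| ≥ K₀ ] · w(|k| − K₀)` (`K₀ ≥ 1`) has sum `2 Σ_n w n`. [folklore] -/
theorem hasSum_int_far {K₀ : ℕ} (hK₀ : 1 ≤ K₀) {w : ℕ → ℝ} (hw : Summable w) :
    HasSum (fun k : ℤ => if |k| < (K₀ : ℤ) then (0 : ℝ) else w (k.natAbs - K₀)) (2 * ∑' n, w n) := by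
  set gs : ℕ → ℝ := fun n => if n < K₀ then 0 else w (n - K₀) with hgs
  have hgK : ∀ n, gs (n + K₀) = w n := by
    intro n; simp only [hgs, if_neg (not_lt.2 (Nat.le_add_left K₀ n)), Nat.add_sub_cancel]
  have hg0 : ∑ i ∈ Finset.range K₀, gs i = 0 :=
    Finset.sum_eq_zero fun i hi => by simp only [hgs, if_pos (Finset.mem_range.1 hi)]
  have hgsum : HasSum gs (∑' n, w n) := by
    have h := (hasSum_nat_add_iff' (f := gs) K₀ (g := ∑' n, w n)).1
    rw [hg0, sub_zero] at h
    exact h (by simpa only [hgK] using hw.hasSum)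
  have hg00 : gs 0 = 0 := by simp only [hgs, if_pos (by omega : 0 < K₀)]
  have hgsum1 : HasSum (fun n => gs (n + 1)) (∑' n, w n) := by
    have h := (hasSum_nat_add_iff' (f := gs) 1 (g := ∑' n, w n)).2 hgsum
    rwa [Finset.sum_range_one, hg00, sub_zero] at h
  have hnat : ∀ n : ℕ, (if |(n : ℤ)| < (K₀ : ℤ) then (0 : ℝ) else w ((n : ℤ).natAbs - K₀)) = gs n := by
    intro n; simp only [hgs, Nat.abs_cast, Nat.cast_lt, Int.natAbs_natCast]
  have hneg : ∀ n : ℕ,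
      (if |(-((n : ℤ) + 1))| < (K₀ : ℤ) then (0 : ℝ) else w ((-((n : ℤ) + 1)).natAbs - K₀)) = gs (n + 1) := by
    intro n
    have e : (-((n : ℤ) + 1)) = -(((n + 1 : ℕ) : ℤ)) := by push_cast; ring
    rw [← hnat (n + 1), e, abs_neg, Int.natAbs_neg]
  have h := HasSum.of_nat_of_neg_add_one
    (f := fun k : ℤ => if |k| < (K₀ : ℤ) then (0 : ℝ) else w (k.natAbs - K₀))
    (by simpa only [hnat] using hgsum) (by simpa only [hneg] using hgsum1)
  rwa [← two_mul] at h

/-- ★ **Upper near/far split.**  If `0 ≤ f`, `f(k) ≤ u(|k| − K₀)` for `|k| ≥ K₀ ≥ 1` with `u ≥ 0` of bounded partial sums `≤ U`,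
then `f` is summable over `ℤ` and `Σ_k f(k) ≤ Σ_{|k| < K₀} f(k) + 2U`. [folklore] -/
theorem tsum_int_le_near_add_far {f : ℤ → ℝ} (hf0 : ∀ k, 0 ≤ f k) {K₀ : ℕ} (hK₀ : 1 ≤ K₀) {u : ℕ → ℝ}
    (hu0 : ∀ n, 0 ≤ u n) (hfar : ∀ k : ℤ, (K₀ : ℤ) ≤ |k| → f k ≤ u (k.natAbs - K₀)) {U : ℝ}
    (hU : ∀ N, ∑ m ∈ Finset.range N, u m ≤ U) :
    Summable f ∧ ∑' k, f k ≤ ∑ k ∈ Finset.Ioo (-(K₀ : ℤ)) K₀, f k + 2 * U := by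
  have hus : Summable u := summable_of_sum_range_le hu0 hU
  have huU : ∑' n, u n ≤ U := Real.tsum_le_of_sum_range_le hu0 hU
  have he := hasSum_int_far hK₀ hus
  set near : ℤ → ℝ := fun k => if |k| < (K₀ : ℤ) then f k else 0 with hnear
  have hmem : ∀ k : ℤ, k ∈ Finset.Ioo (-(K₀ : ℤ)) K₀ ↔ |k| < (K₀ : ℤ) := fun k => by
    rw [Finset.mem_Ioo, abs_lt]
  have hsupp : ∀ k ∉ Finset.Ioo (-(K₀ : ℤ)) K₀, near k = 0 := fun k hk => by
    simp only [hnear, if_neg (mt (hmem k).2 hk)]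
  have hnear_tsum : ∑' k, near k = ∑ k ∈ Finset.Ioo (-(K₀ : ℤ)) K₀, f k := by
    rw [tsum_eq_sum hsupp]
    exact Finset.sum_congr rfl fun k hk => by simp only [hnear, if_pos ((hmem k).1 hk)]
  have hle : ∀ k, f k ≤ near k + (if |k| < (K₀ : ℤ) then (0 : ℝ) else u (k.natAbs - K₀)) := by
    intro k
    by_cases h : |k| < (K₀ : ℤ)
    · simp only [hnear, if_pos h, add_zero, le_refl]
    · simp only [hnear, if_neg h, zero_add]; exact hfar k (not_lt.1 h)
  have hmaj : Summable fun k => near k + (if |k| < (K₀ : ℤ) then (0 : ℝ) else u (k.natAbs - K₀)) :=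
    (summable_of_ne_finset_zero hsupp).add he.summable
  have hfs : Summable f := Summable.of_nonneg_of_le hf0 hle hmaj
  refine ⟨hfs, ?_⟩
  calc ∑' k, f k ≤ ∑' k, (near k + (if |k| < (K₀ : ℤ) then (0 : ℝ) else u (k.natAbs - K₀))) :=
        hfs.tsum_le_tsum hle hmaj
    _ = ∑' k, near k + 2 * ∑' n, u n := by
        rw [Summable.tsum_add (summable_of_ne_finset_zero hsupp) he.summable, he.tsum_eq]
    _ ≤ _ := by rw [hnear_tsum]; linarith

/-- ★ **Lower near/far split.**  If `f` is summable and `f(k) ≥ a·v(|k| − K₀) − c·q(|k| − K₀)` for `|k| ≥ K₀ ≥ 1`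
(`v ≥ 0` summable, `q ≥ 0` with partial sums `≤ T`, `a, c ≥ 0`), then for every `N`
`Σ_{|k|<K₀} f(k) + 2(a·Σ_{m<N} v(m) − c·T) ≤ Σ_k f(k)`. [folklore] -/
theorem near_add_far_le_tsum_int {f : ℤ → ℝ} (hf : Summable f) {K₀ : ℕ} (hK₀ : 1 ≤ K₀) {v q : ℕ → ℝ}
    (hv0 : ∀ n, 0 ≤ v n) (hv : Summable v) (hq0 : ∀ n, 0 ≤ q n) {T : ℝ}
    (hT : ∀ N, ∑ m ∈ Finset.range N, q m ≤ T) {a c : ℝ} (ha : 0 ≤ a) (hc : 0 ≤ c)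
    (hfar : ∀ k : ℤ, (K₀ : ℤ) ≤ |k| → a * v (k.natAbs - K₀) - c * q (k.natAbs - K₀) ≤ f k) (N : ℕ) :
    ∑ k ∈ Finset.Ioo (-(K₀ : ℤ)) K₀, f k + 2 * (a * ∑ m ∈ Finset.range N, v m - c * T) ≤ ∑' k, f k := by
  have hqs : Summable q := summable_of_sum_range_le hq0 hT
  have hqT : ∑' n, q n ≤ T := Real.tsum_le_of_sum_range_le hq0 hT
  have hvN : ∑ m ∈ Finset.range N, v m ≤ ∑' n, v n := hv.sum_le_tsum _ fun n _ => hv0 n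
  have hev := hasSum_int_far hK₀ hv
  have heq := hasSum_int_far hK₀ hqs
  set near : ℤ → ℝ := fun k => if |k| < (K₀ : ℤ) then f k else 0 with hnear
  have hmem : ∀ k : ℤ, k ∈ Finset.Ioo (-(K₀ : ℤ)) K₀ ↔ |k| < (K₀ : ℤ) := fun k => by
    rw [Finset.mem_Ioo, abs_lt]
  have hsupp : ∀ k ∉ Finset.Ioo (-(K₀ : ℤ)) K₀, near k = 0 := fun k hk => by
    simp only [hnear, if_neg (mt (hmem k).2 hk)]
  have hnear_tsum : ∑' k, near k = ∑ k ∈ Finset.Ioo (-(K₀ : ℤ)) K₀, f k := by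
    rw [tsum_eq_sum hsupp]
    exact Finset.sum_congr rfl fun k hk => by simp only [hnear, if_pos ((hmem k).1 hk)]
  set ℓ : ℤ → ℝ := fun k => near k + (a * (if |k| < (K₀ : ℤ) then (0 : ℝ) else v (k.natAbs - K₀)) -
      c * (if |k| < (K₀ : ℤ) then (0 : ℝ) else q (k.natAbs - K₀))) with hℓ
  have hℓs : HasSum ℓ (∑ k ∈ Finset.Ioo (-(K₀ : ℤ)) K₀, f k + (a * (2 * ∑' n, v n) - c * (2 * ∑' n, q n))) := by
    have h1 : HasSum near (∑ k ∈ Finset.Ioo (-(K₀ : ℤ)) K₀, f k) := by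
      rw [← hnear_tsum]; exact (summable_of_ne_finset_zero hsupp).hasSum
    exact h1.add ((hev.mul_left a).sub (heq.mul_left c))
  have hle : ∀ k, ℓ k ≤ f k := by
    intro k
    by_cases h : |k| < (K₀ : ℤ)
    · simp only [hℓ, hnear, if_pos h, mul_zero, sub_zero, add_zero, le_refl]
    · simp only [hℓ, hnear, if_neg h, zero_add]; exact hfar k (not_lt.1 h)
  have h := hℓs.summable.tsum_le_tsum hle hf
  rw [hℓs.tsum_eq] at h
  nlinarith [mul_le_mul_of_nonneg_left hvN ha, mul_le_mul_of_nonneg_left hqT hc]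

/-- Bounded partial sums of a geometric series `Σ Q^m ≤ 1/(1−Q)` (`0 ≤ Q < 1`). [folklore] (dedup gate: public twins (HolmgrenBoyleLind.hbl_Gamma_three/six, Literature.Barriers.NavierStokesRegularity.Dyadic.geom_sum_le_inv) live in unrelated modules; kept PRIVATE here) -/
private theorem sum_range_pow_le_of_lt_one {Q : ℝ} (hQ0 : 0 ≤ Q) (hQ1 : Q < 1) (N : ℕ) :
    ∑ m ∈ Finset.range N, Q ^ m ≤ 1 / (1 - Q) := by
  rw [one_div, ← tsum_geometric_of_lt_one hQ0 hQ1]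
  exact (summable_geometric_of_lt_one hQ0 hQ1).sum_le_tsum _ fun n _ => pow_nonneg hQ0 n

end IntSums

/-! ## §G6 Numerical constants: `Γ(3)`, `Γ(6)`, the shifted `ζ`-tails -/

section Constants

/-- `gamma_three_eq` (docstring added by the landing lane; see the module docstring). [formal bookkeeping] (dedup gate: public twins (HolmgrenBoyleLind.hbl_Gamma_three/six, Literature.Barriers.NavierStokesRegularity.Dyadic.geom_sum_le_inv) live in unrelated modules; kept PRIVATE here) -/
private theorem gamma_three_eq : Real.Gamma 3 = 2 := by
  rw [show (3 : ℝ) = ((2 : ℕ) : ℝ) + 1 by norm_num, Real.Gamma_nat_eq_factorial]; norm_num [Nat.factorial]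

/-- `gamma_six_eq` (docstring added by the landing lane; see the module docstring). [formal bookkeeping] (dedup gate: public twins (HolmgrenBoyleLind.hbl_Gamma_three/six, Literature.Barriers.NavierStokesRegularity.Dyadic.geom_sum_le_inv) live in unrelated modules; kept PRIVATE here) -/
private theorem gamma_six_eq : Real.Gamma 6 = 120 := by
  rw [show (6 : ℝ) = ((5 : ℕ) : ℝ) + 1 by norm_num, Real.Gamma_nat_eq_factorial]; norm_num [Nat.factorial]

/-- `Σ_{m<N} (m+4)^{-4} ≤ ζ(4) − 1 − 2^{-4} − 3^{-4} = π⁴/90 − 1393/1296`. [Euler, `hasSum_zeta_four`] -/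
theorem sum_range_inv_pow_four_shift_le (N : ℕ) :
    ∑ m ∈ Finset.range N, ((((m + 4 : ℕ) : ℝ)) ^ 4)⁻¹ ≤ π ^ 4 / 90 - 1393 / 1296 := by
  have h := (hasSum_nat_add_iff' (f := fun n : ℕ => (1 : ℝ) / (n : ℝ) ^ 4) 4).2 hasSum_zeta_four
  have h4 : ∑ i ∈ Finset.range 4, (1 : ℝ) / (i : ℝ) ^ 4 = 1393 / 1296 := by
    simp only [Finset.sum_range_succ, Finset.sum_range_zero]; norm_num
  rw [h4] at h
  have hle := h.summable.sum_le_tsum (Finset.range N) fun n _ => by positivity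
  rw [h.tsum_eq] at hle
  refine le_trans (le_of_eq (Finset.sum_congr rfl fun m _ => ?_)) hle
  rw [one_div]

/-- `Σ_{m<N} (m+4)^{-(d+1)} ≤ 1/(d·3^d)` (`d ≥ 1`). [folklore, `StackingSums.sum_inv_pow_Ioc_le`] -/
theorem sum_range_inv_pow_shift_le {d : ℕ} (hd : 1 ≤ d) (N : ℕ) :
    ∑ m ∈ Finset.range N, ((((m + 4 : ℕ) : ℝ)) ^ (d + 1))⁻¹ ≤ 1 / d * ((3 : ℝ)⁻¹) ^ d := by
  have h := StackingSums.sum_inv_pow_Ioc_le hd (K := 3) (by norm_num) N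
  refine le_trans (le_of_eq (Finset.sum_congr rfl fun m _ => ?_)) (h.trans_eq (by norm_num))
  rw [← inv_pow]

/-- casting helper: for `|k| ≥ 4`, `((|k| − 4) + 4 : ℕ) = |k|` in `ℝ`. -/
theorem cast_natAbs_sub_four_add_four {k : ℤ} (hk : (4 : ℤ) ≤ |k|) :
    (((k.natAbs - 4 + 4 : ℕ)) : ℝ) = |(k : ℝ)| := by
  have h4 : 4 ≤ k.natAbs := by
    have h := hk; rw [Int.abs_eq_natAbs] at h; exact_mod_cast h
  rw [Nat.sub_add_cancel h4, Nat.cast_natAbs, Int.cast_abs]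

end Constants

/-! ## §G7 The WINDOW SUMS: exact near part (`|k| ≤ 3`) + one uniform far enclosure (`|k| ≥ 4`)

For a window `w` and a linear part `B` the record's window sums are `T₃↑(w,B) = Σ'_k layerUp w B 6 k` and
`T₆↓(w,B) = Σ'_k layerLo w B 12 k` (tree `…FarCoreWindowsB`).  With ONE certified dual row per exponent
(`μ = 2` for `n = 6`, `μ = 5` for `n = 12`) and the height/area enclosures `δ₁ ≤ δ_B ≤ δ₂`, `D₁ ≤ D_B ≤ D₂`
of the box, the far part `|k| ≥ 4` is enclosed in closed form: main term `ζ`-tail + a geometric remainder. -/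

section Window

variable (w : Fin 6 → ℤ) (B : E3 →ₗ[ℝ] E3) (hB : Function.Injective B)
    [MeasurableSpace (Submodule.span ℝ (Set.range ![B (triangularVec₁ 1), B (triangularVec₂ 1)]))]
    [BorelSpace (Submodule.span ℝ (Set.range ![B (triangularVec₁ 1), B (triangularVec₂ 1)]))]
    (R : DualRow) (hR : R.check = true) (hbd : 0 ≤ R.bound)
    (h00 : (R.g00lo : ℝ) ≤ ‖B (triangularVec₁ 1)‖ ^ 2 ∧ ‖B (triangularVec₁ 1)‖ ^ 2 ≤ R.g00hi)
    (h01 : (R.g01lo : ℝ) ≤ ⟪B (triangularVec₁ 1), B (triangularVec₂ 1)⟫_ℝ ∧ ⟪B (triangularVec₁ 1), B (triangularVec₂ 1)⟫_ℝ ≤ R.g01hi)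
    (h11 : (R.g11lo : ℝ) ≤ ‖B (triangularVec₂ 1)‖ ^ 2 ∧ ‖B (triangularVec₂ 1)‖ ^ 2 ≤ R.g11hi)
    {δ₁ δ₂ D₁ D₂ : ℝ} (hδ₁ : 0 < δ₁)
    (hδ₁' : δ₁ ≤ ‖B (layerNormal (Real.sqrt (2 / 3))) - (Submodule.span ℝ
        (Set.range ![B (triangularVec₁ 1), B (triangularVec₂ 1)])).starProjection (B (layerNormal (Real.sqrt (2 / 3))))‖)
    (hδ₂ : ‖B (layerNormal (Real.sqrt (2 / 3))) - (Submodule.span ℝ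
        (Set.range ![B (triangularVec₁ 1), B (triangularVec₂ 1)])).starProjection (B (layerNormal (Real.sqrt (2 / 3))))‖ ≤ δ₂)
    (hdlo : (R.dlo : ℝ) ≤ 4 * δ₁) (hD₁ : 0 < D₁)
    (hD₁' : D₁ ≤ ‖B (triangularVec₁ 1)‖ ^ 2 * ‖B (triangularVec₂ 1)‖ ^ 2 - ⟪B (triangularVec₁ 1), B (triangularVec₂ 1)⟫_ℝ ^ 2)
    (hD₂ : ‖B (triangularVec₁ 1)‖ ^ 2 * ‖B (triangularVec₂ 1)‖ ^ 2 - ⟪B (triangularVec₁ 1), B (triangularVec₂ 1)⟫_ℝ ^ 2 ≤ D₂)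
    {r₀ : ℚ} (hr₀ : 0 ≤ r₀) (hr : r₀ ^ 2 * (R.g00hi + R.g11hi) ≤ 1) {Q : ℝ}
    (hQ : Real.exp (-(2 * π * δ₁ * r₀)) ≤ Q) (hQ1 : Q < 1)

include hB hR hbd h00 h01 h11 hδ₁ hδ₁' hδ₂ hdlo hD₁ hD₁' hD₂ hr₀ hr hQ hQ1

/-- ★★ **Upper window sum, far part enclosed** (`n = 6`, row with `μ = 2`):
`T₃↑(w,B) ≤ Σ_{|k|≤3} S_B(6,k,label) + 2·( π/(2√D₁ δ₁⁴)·(ζ(4) − 1 − 2⁻⁴ − 3⁻⁴) + (π/√Dlo)·bound/(1 − Q) )`,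
and `k ↦ layerUp w B 6 k` is summable (no extra hypothesis). -/
theorem windowSixUp_le_near_add_far (hμ : R.μ + 1 = 3) :
    Summable (fun k => layerUp w B 6 k) ∧
    windowSixUp w B ≤ ∑ k ∈ Finset.Ioo (-4 : ℤ) 4, layerSum B 6 k (windowLabel w k) +
      2 * (π / (2 * Real.sqrt D₁ * δ₁ ^ 4) * (π ^ 4 / 90 - 1393 / 1296) +
        π / Real.sqrt R.Dlo * R.bound * (1 / (1 - Q))) := by
  have hQ0 : 0 ≤ Q := (Real.exp_pos _).le.trans hQ
  have hbd' : (0 : ℝ) ≤ R.bound := by exact_mod_cast hbd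
  set a : ℝ := π / (2 * Real.sqrt D₁ * δ₁ ^ 4) with ha
  set C : ℝ := π / Real.sqrt R.Dlo * R.bound with hC
  have ha0 : 0 ≤ a := by positivity
  have hC0 : 0 ≤ C := mul_nonneg (div_nonneg Real.pi_pos.le (Real.sqrt_nonneg _)) hbd'
  set u : ℕ → ℝ := fun n => a * ((((n + 4 : ℕ) : ℝ)) ^ 4)⁻¹ + C * Q ^ n with hu
  have hu0 : ∀ n, 0 ≤ u n := fun n => by positivity
  have hU : ∀ N, ∑ m ∈ Finset.range N, u m ≤ a * (π ^ 4 / 90 - 1393 / 1296) + C * (1 / (1 - Q)) := by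
    intro N
    rw [Finset.sum_add_distrib, ← Finset.mul_sum, ← Finset.mul_sum]
    exact add_le_add (mul_le_mul_of_nonneg_left (sum_range_inv_pow_four_shift_le N) ha0)
      (mul_le_mul_of_nonneg_left (sum_range_pow_le_of_lt_one hQ0 hQ1 N) hC0)
  have hfar : ∀ k : ℤ, ((4 : ℕ) : ℤ) ≤ |k| → layerUp w B 6 k ≤ u (k.natAbs - 4) := by
    intro k hk
    have hk' : (4 : ℤ) ≤ |k| := by exact_mod_cast hk
    have hnot : ¬ |k| ≤ 3 := by omega
    have hbnd : ∀ o : ℤ, layerSum B 6 k o ≤ u (k.natAbs - 4) := by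
      intro o
      have h := (layerSum_far_encl_uniform B hB 3 (by norm_num) hk' o R hR hμ h00 h01 h11 hδ₁ hδ₁' hδ₂ hdlo hD₁
        hD₁' hD₂ hr₀ hr hQ).2
      have e2 : (2 * 3 - 2 : ℕ) = 4 := by norm_num
      have e1 : (2 * 3 : ℕ) = 6 := by norm_num
      rw [e2, e1] at h
      simp only [Nat.cast_ofNat] at h
      rw [gamma_three_eq] at h
      refine h.trans (le_of_eq ?_)
      rw [hu]; dsimp only
      rw [cast_natAbs_sub_four_add_four hk', ha, hC, mul_pow]; ring
    unfold layerUp; rw [if_neg hnot]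
    exact max_le (hbnd 0) (max_le (hbnd 1) (hbnd 2))
  obtain ⟨hs, hle⟩ := tsum_int_le_near_add_far (layerUp_nonneg w B 6) (by norm_num : 1 ≤ 4) hu0 hfar hU
  refine ⟨hs, ?_⟩
  unfold windowSixUp
  refine hle.trans (le_of_eq ?_)
  have hnear : ∑ k ∈ Finset.Ioo (-((4 : ℕ) : ℤ)) ((4 : ℕ) : ℤ), layerUp w B 6 k =
      ∑ k ∈ Finset.Ioo (-4 : ℤ) 4, layerSum B 6 k (windowLabel w k) := by
    refine Finset.sum_congr (by norm_num) fun k hk => ?_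
    rw [Finset.mem_Ioo] at hk
    unfold layerUp; rw [if_pos (abs_le.2 ⟨by omega, by omega⟩)]
  rw [hnear]

/-- ★★ **Lower window sum, far part enclosed** (`n = 12`, row with `μ = 5`): for every `N`,
`Σ_{|k|≤3} S_B(12,k,label) + 2·( π/(5√D₂ δ₂¹⁰)·Σ_{m<N}(m+4)^{-10} − (π/(60√Dlo))·bound/(1 − Q) ) ≤ T₆↓(w,B)`,
and `k ↦ layerLo w B 12 k` is summable. -/
theorem near_add_far_le_windowTwelveLo (hμ : R.μ + 1 = 6) (N : ℕ) :
    Summable (fun k => layerLo w B 12 k) ∧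
    ∑ k ∈ Finset.Ioo (-4 : ℤ) 4, layerSum B 12 k (windowLabel w k) +
      2 * (π / (5 * Real.sqrt D₂ * δ₂ ^ 10) * ∑ m ∈ Finset.range N, ((((m + 4 : ℕ) : ℝ)) ^ 10)⁻¹ -
        π / (60 * Real.sqrt R.Dlo) * R.bound * (1 / (1 - Q))) ≤ windowTwelveLo w B := by
  have hQ0 : 0 ≤ Q := (Real.exp_pos _).le.trans hQ
  have hδ₂0 : 0 < δ₂ := lt_of_lt_of_le (lt_of_lt_of_le hδ₁ hδ₁') hδ₂
  have hD₂0 : 0 < D₂ := lt_of_lt_of_le (lt_of_lt_of_le hD₁ hD₁') hD₂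
  -- (1) summability of `layerLo w B 12 ·` from the UPPER uniform bound with the same row
  have hbd' : (0 : ℝ) ≤ R.bound := by exact_mod_cast hbd
  set aU : ℝ := π / (5 * Real.sqrt D₁ * δ₁ ^ 10) with haU
  set C : ℝ := π / (60 * Real.sqrt R.Dlo) * R.bound with hC
  have hC0 : 0 ≤ C := mul_nonneg (div_nonneg Real.pi_pos.le (by positivity)) hbd'
  set u : ℕ → ℝ := fun n => aU * ((((n + 4 : ℕ) : ℝ)) ^ 10)⁻¹ + C * Q ^ n with hu
  have hu0 : ∀ n, 0 ≤ u n := fun n => by positivity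
  have hU : ∀ M, ∑ m ∈ Finset.range M, u m ≤ aU * (1 / (9 : ℕ) * ((3 : ℝ)⁻¹) ^ 9) + C * (1 / (1 - Q)) := by
    intro M
    rw [Finset.sum_add_distrib, ← Finset.mul_sum, ← Finset.mul_sum]
    exact add_le_add (mul_le_mul_of_nonneg_left (sum_range_inv_pow_shift_le (by norm_num) M) (by positivity))
      (mul_le_mul_of_nonneg_left (sum_range_pow_le_of_lt_one hQ0 hQ1 M) hC0)
  have hencl : ∀ k : ℤ, (4 : ℤ) ≤ |k| → ∀ o : ℤ,
      π / (5 * Real.sqrt D₂ * δ₂ ^ 10) * ((((k.natAbs - 4 + 4 : ℕ) : ℝ)) ^ 10)⁻¹ - C * Q ^ (k.natAbs - 4) ≤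
        layerSum B 12 k o ∧ layerSum B 12 k o ≤ u (k.natAbs - 4) := by
    intro k hk o
    have h := layerSum_far_encl_uniform B hB 6 (by norm_num) hk o R hR hμ h00 h01 h11 hδ₁ hδ₁' hδ₂ hdlo hD₁
      hD₁' hD₂ hr₀ hr hQ
    have e2 : (2 * 6 - 2 : ℕ) = 10 := by norm_num
    have e1 : (2 * 6 : ℕ) = 12 := by norm_num
    rw [e2, e1] at h
    simp only [Nat.cast_ofNat] at h
    rw [gamma_six_eq] at h
    rw [hu]; dsimp only
    rw [cast_natAbs_sub_four_add_four hk, haU, hC]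
    constructor
    · refine le_trans (le_of_eq ?_) h.1
      rw [mul_pow]; ring
    · refine h.2.trans (le_of_eq ?_)
      rw [mul_pow]; ring
  have hfarU : ∀ k : ℤ, ((4 : ℕ) : ℤ) ≤ |k| → layerLo w B 12 k ≤ u (k.natAbs - 4) := by
    intro k hk
    have hk' : (4 : ℤ) ≤ |k| := by exact_mod_cast hk
    have hnot : ¬ |k| ≤ 3 := by omega
    unfold layerLo; rw [if_neg hnot]
    exact (min_le_left _ _).trans (hencl k hk' 0).2
  obtain ⟨hs, -⟩ := tsum_int_le_near_add_far (layerLo_nonneg w B 12) (by norm_num : 1 ≤ 4) hu0 hfarU hU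
  refine ⟨hs, ?_⟩
  -- (2) the lower bound
  set v : ℕ → ℝ := fun n => ((((n + 4 : ℕ) : ℝ)) ^ 10)⁻¹ with hv
  have hv0 : ∀ n, 0 ≤ v n := fun n => by positivity
  have hvs : Summable v := summable_of_sum_range_le hv0 (sum_range_inv_pow_shift_le (d := 9) (by norm_num))
  have hfarL : ∀ k : ℤ, ((4 : ℕ) : ℤ) ≤ |k| →
      π / (5 * Real.sqrt D₂ * δ₂ ^ 10) * v (k.natAbs - 4) - C * (fun n : ℕ => Q ^ n) (k.natAbs - 4) ≤
        layerLo w B 12 k := by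
    intro k hk
    have hk' : (4 : ℤ) ≤ |k| := by exact_mod_cast hk
    have hnot : ¬ |k| ≤ 3 := by omega
    unfold layerLo; rw [if_neg hnot]
    exact le_min (hencl k hk' 0).1 (le_min (hencl k hk' 1).1 (hencl k hk' 2).1)
  have hle := near_add_far_le_tsum_int hs (by norm_num : 1 ≤ 4) hv0 hvs (fun n => pow_nonneg hQ0 n)
    (sum_range_pow_le_of_lt_one hQ0 hQ1) (by positivity) hC0 hfarL N
  unfold windowTwelveLo
  refine le_trans (le_of_eq ?_) hle
  have hnear : ∑ k ∈ Finset.Ioo (-((4 : ℕ) : ℤ)) ((4 : ℕ) : ℤ), layerLo w B 12 k =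
      ∑ k ∈ Finset.Ioo (-4 : ℤ) 4, layerSum B 12 k (windowLabel w k) := by
    refine Finset.sum_congr (by norm_num) fun k hk => ?_
    rw [Finset.mem_Ioo] at hk
    unfold layerLo; rw [if_pos (abs_le.2 ⟨by omega, by omega⟩)]
  rw [hnear]

end Window

end Summit.AtomisticToContinuum.Crystallization.Theorems.OverbindingBudgetAffineFarSmoothSplit

end
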